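import Summits.CriticalPhenomena.PercolationContinuityZ3.Theorems.PercNearOneGluingNoHeavyQuantReflectionGatesClosed
import Summits.CriticalPhenomena.PercolationContinuityZ3.Theorems.PercNearOneGluingNoHeavyQuantSingleLowCells
import HarnessLib

/-!
# QUANT lane R8, T-DEC: WHAT IS LEFT OF CONJECTURE BLOB-AFL FOR ALL WIDTHS after the Hoeffding reduction — exactly two families of
# one-parameter statements with `g < 1/2`: the equal-gates band and the lowered-target cells (prim-quant-census-2 gen 83, file 18)

builds on p205010 (kernel theorem, internal audit signed; external expert review pending)

Support file (`--supports stmt-CriticalPhenomena-4575`), QUANT lane census seat prim-quant-census-2 (gen 83); memo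
`run/shared/lean/prim/quant/prim-quant-census-2-g83/HOEFFDING-G83.md` §6.  Theorems only, standard axioms, no sorries, no definitions.

The reduction `heavy_blobLaw_of_onesEqualFamily` (`…QuantThreeValuedReduction`), the reflection cells (`heavy_onesEqual_of_half_le_floor`,
every `g ≥ 1/2`, every `(m, r)`) and the zero-only-low lemma (`heavy_blobLaw_of_mean_le_two`, every `r·g ≤ 2`) leave, for ALL widths at once,
exactly two families, both with `g < 1/2`:
(E) EQUAL GATES IN THE BAND: for every `r` and `2/r < g < 1/2`, `r` equal blobs `(k,g)` are heavy at floor `g`, target `k·r·g`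
    (kernel for `r ≤ 9`: `heavy_blobLaw_replicate_five…nine`; conjecture C of census-2 g82 is one candidate certificate for every `r`);
(L) LOWERED-TARGET CELLS: for every `m ≥ 1`, `r`, `g < 1/2` with `m < r·g`, `r` equal blobs `(k,g)` are heavy at floor `(m + r·g)/(m + r)`, target
    `k·(r·g − m)` (kernel for `m + r ≤ 9`: `heavy_c13 … heavy_c18f`; uniform-spreading loads `≤ 0.66`, memo §1).
* **`heavy_blobLaw_of_bandFamilies`** — (E) ∧ (L) ⟹ conjecture BLOB-AFL for EVERY gate list `G ⊂ [0,1]` of EVERY width (and every `k ≥ 1`).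

HONEST STATUS.  (E) and (L) are OPEN for general `r` (this file proves the implication only; nothing is assumed as a fact); `SiblingStep`,
`FarTreeRow`, `GluedLemmaW`, `GluedDominatedMass` OPEN; RATE class (log\*) / honest sentence of `run/shared/lean/prim/quant/README.md` unchanged.
[this work].  Nothing here is cited as a published result.  The gluing rows served [cite: KozmaNitzan2024, Conjecture 3 (p. 15)]; product measure
[cite: Grimmett1999, §1.3 p. 10].
-/

noncomputable section

open scoped BigOperators

namespace Summit.CriticalPhenomena.PercolationContinuityZ3.Theorems
namespace Quant

open Finset

/-- the two-point law `{lo, hi; g}` (as in `…QuantLawDEC`) -/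
local notation3 "TP[" lo ", " hi ", " g ", " h "]" =>
  (g : ℝ) * (if (h : ℕ) = (hi : ℕ) then (1 : ℝ) else 0) + (1 - (g : ℝ)) * (if (h : ℕ) = (lo : ℕ) then (1 : ℝ) else 0)

/-- a HEAVY decomposition of the law `μ` on `{0..M}` at floor `x`, target `T` (the inline `∃` consumed by `decAtT_of_heavy`) -/
local notation3 "HEAVY[" x ", " T ", " M ", " μ "]" =>
  ∃ (ι : Type) (_ : Fintype ι) (lam γ : ι → ℝ) (lo hi : ι → ℕ),
    (∀ i, 0 ≤ lam i) ∧ (∑ i, lam i = 1) ∧ (∀ i, 0 ≤ γ i ∧ γ i ≤ 1) ∧ (∀ i, lo i ≤ hi i) ∧ (∀ i, hi i ≤ (M : ℕ)) ∧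
    (∀ h, (μ : ℕ → ℝ) h = ∑ i, lam i * TP[lo i, hi i, γ i, h]) ∧
    (∀ i, 0 < lam i → (x : ℝ) ≤ γ i ∧ (T : ℝ) ≤ 2 * (lo i : ℝ) + ((hi i : ℝ) - lo i) * γ i)

/-- the blob list of a gate list at the common blob size `k` -/
local notation3 "BL[" k ", " G "]" => LawDec.blobLaw (List.map (fun g : ℝ => ((k : ℕ), g)) G)

namespace LawDec

/-- **BLOB-AFL FOR ALL WIDTHS FROM THE TWO BAND FAMILIES.**  If (E) for every `r` and `2 < r·g`, `g < 1/2`, `r` equal blobs `(k,g)` are heavy at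
`(g, k·r·g)`, and (L) for every `m ≥ 1`, `r`, `g < 1/2` with `m < r·g` they are heavy at floor `(m + r·g)/(m + r)` and target `k·(r·g − m)`, then
`blobLaw (G.map (k,·))` is heavy at `(ΣG/|G|, k·ΣG)` for EVERY gate list `G ⊂ [0,1]`. [this work] -/
theorem heavy_blobLaw_of_bandFamilies (k : ℕ) (hk : 0 < k)
    (HE : ∀ (r : ℕ) (g : ℝ), 0 < g → g < 1 / 2 → 2 < (r : ℝ) * g →
      HEAVY[g, (k : ℝ) * (r * g), r * k, blobLaw (List.replicate r (k, g))])
    (HL : ∀ (m r : ℕ) (g : ℝ), 0 < m → 0 < g → g < 1 / 2 → (m : ℝ) < r * g →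
      HEAVY[((m : ℝ) + r * g) / ((m : ℝ) + r), (k : ℝ) * (r * g - m), r * k, blobLaw (List.replicate r (k, g))])
    (G : List ℝ) (hG : ∀ g ∈ G, 0 ≤ g ∧ g ≤ 1) :
    HEAVY[G.sum / G.length, (k : ℝ) * G.sum, G.length * k, BL[k, G]] := by
  refine heavy_blobLaw_of_onesEqualFamily k G hG fun m r g hmr hg0 hg1 hS hlow => ?_
  have hr : 0 < r := by
    rcases Nat.eq_zero_or_pos r with h0 | h0
    · exfalso; subst h0
      simp only [Nat.cast_zero, zero_mul] at hlow
      linarith [Nat.cast_nonneg (α := ℝ) m]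
    · exact h0
  have hr' : (0 : ℝ) < r := by exact_mod_cast hr
  have hk' : (0 : ℝ) < k := by exact_mod_cast hk
  have hmr' : ((m : ℝ) + r) ≤ G.length := by exact_mod_cast hmr
  have hmrpos : (0 : ℝ) < (m : ℝ) + r := by positivity
  have hSnn : 0 ≤ (m : ℝ) + r * g := by positivity
  have hx : G.sum / G.length ≤ ((m : ℝ) + r * g) / ((m : ℝ) + r) := by
    rw [← hS]; exact div_le_div_of_nonneg_left hSnn hmrpos hmr'
  rcases le_or_gt (1 / 2 : ℝ) g with hhalf | hhalf
  · -- reflection cells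
    have key := heavy_onesEqual_of_half_le_floor k m r hhalf hg1 hr hx
    rw [hS] at key
    exact key
  -- `g < 1/2`: convert a shifted-form statement into the list form
  suffices hcell : HEAVY[G.sum / G.length, (k : ℝ) * (r * g - m), r * k, blobLaw (List.replicate r (k, g))] by
    have key := heavy_onesEqual_of_shifted k m r g _ hcell
    rw [hS] at key
    exact key
  rcases Nat.eq_zero_or_pos m with hm0 | hmpos
  · -- equal gates
    subst hm0
    simp only [Nat.cast_zero, zero_add] at hx hlow ⊢
    have hxg : G.sum / G.length ≤ g := by rwa [mul_div_cancel_left₀ g hr'.ne'] at hx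
    rw [sub_zero]
    by_cases hrg : (r : ℝ) * g ≤ 2
    · -- zero-only-low regime
      have hl : ∀ p ∈ List.replicate r (k, g), p.1 = k ∧ 0 ≤ p.2 ∧ p.2 ≤ 1 := fun p hp => by
        rw [List.eq_of_mem_replicate hp]; exact ⟨rfl, hg0.le, hg1.le⟩
      have htop : blobTop (List.replicate r (k, g)) = r * k := blobTop_replicate r k g
      have hmean : blobMean (List.replicate r (k, g)) = (r : ℝ) * k * g := by rw [blobMean_replicate]
      have hm0' : 0 < blobMean (List.replicate r (k, g)) := by rw [hmean]; positivity
      have hm2 : blobMean (List.replicate r (k, g)) ≤ 2 * k := by rw [hmean]; nlinarith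
      have key := heavy_blobLaw_of_mean_le_two k _ hl hm0' hm2
      rw [hmean, htop] at key
      have e1 : (r : ℝ) * k * g / ((r * k : ℕ) : ℝ) = g := by push_cast; field_simp
      have e2 : (r : ℝ) * k * g = (k : ℝ) * (r * g) := by ring
      rw [e1, e2] at key
      exact heavy_mono _ _ _ _ _ _ hxg le_rfl key
    · exact heavy_mono _ _ _ _ _ _ hxg le_rfl (HE r g hg0 hhalf (not_le.1 hrg))
  · exact heavy_mono _ _ _ _ _ _ hx le_rfl (HL m r g hmpos hg0 hhalf hlow)

end LawDec
end Quant
end Summit.CriticalPhenomena.PercolationContinuityZ3.Theorems
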